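import Summits.Ventures.HSemireg.WedgeHankelRecurrenceGaussResolvent

/-!
# Venture HSemireg — **THE DISTRIBUTION FUNCTION AND ITS GAUSS APPROXIMANT DIFFER BY AT MOST THE LARGEST CHRISTOFFEL NUMBER, AT EVERY REAL POINT**: if `(λ, x)` (`x_0 < ⋯ < x_t`) is exact for the
# measure `ν ≥ 0` in degree `≤ 2t`, then for every real `ξ`: `Σ_{x_j ≤ ξ} λ_j − λ_k ≤ ν{w ≤ ξ} ≤ Σ_{x_j ≤ ξ} λ_j + λ_m` (`x_k` the last node `≤ ξ`, `x_m` the first node `> ξ`), hence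
# `|ν{w ≤ ξ} − Σ_{x_j ≤ ξ} λ_j| ≤ max_j λ_j` (Chebyshev–Markov–Stieltjes between the nodes)

HONEST FRAMING. Part of the Lean index of the computation cell `pub-hsemireg` (seat p10 gen 43, Sunday typer «UNIFORM-IN-n»).  Finite sums over filtered index sets only; no variety, no cohomology
theory, no sheaf, no Ext group and no semiregularity map is constructed here; nothing here says that HC / HC_CM / HC_AV holds; no Literature fact (unproved `Prop`) is declared or used.  Custodian
versions as in `WedgeHankelSiegelIdeal` (1/3).
SOURCES (cited).  G. Szegő, *Orthogonal Polynomials*, Thm 3.41.1 and the remark following it (separation theorem of Chebyshev–Markov–Stieltjes; the step function of the Gauss rule stays within one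
jump of the distribution); G. Freud, *Orthogonal Polynomials* (1971), Thm I.5.4 ∕ §III.1 (`|α(x) − α_n(x)| ≤ λ_n`-type estimates); T. J. Stieltjes (1884/1894); A. A. Markov (1884); N. I. Akhiezer,
*The Classical Moment Problem*, Thm 2.5.4.
PROOF TYPED HERE.  With `m = min {j : ξ < x_j}` one has `{j : x_j ≤ ξ} = {j : j < m}` (strict monotonicity) and `{l : w_l ≤ ξ} ⊆ {l : w_l < x_m}`, so N271 `chebyshev_markov_stieltjes` at `x_m`
gives the upper bound; with `k = max {j : x_j ≤ ξ}` symmetrically `{j : x_j ≤ ξ} = {j : j ≤ k}`, `{l : w_l ≤ x_k} ⊆ {l : w_l ≤ ξ}` and N271 at `x_k` gives the lower bound; the empty cases use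
`Σ λ = Σ ν` (`p = 0`) and `ν ≥ 0`.
DEDUP DISCLOSURE (`rg -n 'distribution_sub|mass_le_xi|gaussStep' Summits/Ventures/HSemireg`, 2026-09-03): N271 ∕ N272 are the inequalities AT THE NODES; N295 ∕ N297 at an arbitrary point use a
DIFFERENT rule (through `ξ`); here the SAME rule is compared with `ν` between its nodes.  The 4 names below: 0 hits tree-wide.

WHAT IS IN THE TREE.  N271 `chebyshev_markov_stieltjes`; N272 `sum_filter_le_eq_sum_filter_lt_add`; Mathlib `Finset.min'`, `Finset.max'`, `Finset.min'_mem`, `Finset.min'_le`, `Finset.le_max'`,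
`Finset.sum_le_sum_of_subset_of_nonneg`, `Finset.filter_congr`.
THIS FILE (namespace `Summit.Ventures.HSemireg.Wedge.HankelOuter` continued; CHAINED on N310 (import), N271, N272; 0 definitions):
* §1076 `mass_le_le_gaussStep_add` (upper bound `ν{w ≤ ξ} ≤ Σ_{x_j ≤ ξ} λ_j + M` for any `M ≥ λ_j ∀ j`, `M ≥ 0`), `gaussStep_sub_le_mass_le` (lower bound `Σ_{x_j ≤ ξ} λ_j − M ≤ ν{w ≤ ξ}`),
  **`abs_mass_le_sub_gaussStep_le`** (SZEGŐ 3.41.1 between the nodes: `|ν{w ≤ ξ} − Σ_{x_j ≤ ξ} λ_j| ≤ M`), `abs_mass_le_sub_gaussStep_le_sum` (the parameter-free case `M = Σ_j λ_j = Σ_l ν_l` for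
  `λ ≥ 0`).
CAVEATS.  `max_j λ_j` is handled as "any common upper bound `M`" (no `Finset.sup'` bookkeeping).  Nothing Ext-side.  New names only.
-/

open Module Polynomial
open scoped Matrix Polynomial

namespace Summit.Ventures.HSemireg.Wedge.HankelOuter

/-! ## §1076. `|ν{w ≤ ξ} − Σ_{x_j ≤ ξ} λ_j| ≤ max_j λ_j` at every real `ξ` -/

/-- **Upper bound between the nodes**: `ν{w ≤ ξ} ≤ Σ_{x_j ≤ ξ} λ_j + M` whenever `λ_j ≤ M` for all `j` and `0 ≤ M` (rule exact in degree `≤ 2t`, `ν ≥ 0`, nodes strictly increasing).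
[Szegő Thm 3.41.1; this file, §1076] -/
theorem mass_le_le_gaussStep_add {t N : ℕ} {μ x : Fin (t + 1) → ℝ} {ν w : Fin N → ℝ} (hx : StrictMono x) (hν : ∀ l, 0 ≤ ν l)
    (hmom : ∀ p, p ≤ 2 * t → ∑ j, μ j * x j ^ p = ∑ l, ν l * w l ^ p) {M : ℝ} (hM : ∀ j, μ j ≤ M) (hM0 : 0 ≤ M) (ξ : ℝ) :
    ∑ l ∈ Finset.univ.filter (fun l => w l ≤ ξ), ν l ≤ ∑ j ∈ Finset.univ.filter (fun j => x j ≤ ξ), μ j + M := by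
  by_cases hS : (Finset.univ.filter (fun j : Fin (t + 1) => ξ < x j)).Nonempty
  · set m := (Finset.univ.filter (fun j : Fin (t + 1) => ξ < x j)).min' hS with hm
    have hmS : ξ < x m := (Finset.mem_filter.1 (Finset.min'_mem _ hS)).2
    have hstep : Finset.univ.filter (fun j => x j ≤ ξ) = Finset.univ.filter (fun j => j < m) := by
      refine Finset.filter_congr fun j _ => ⟨fun h => ?_, fun h => ?_⟩
      · by_contra hjm
        exact absurd (h.trans_lt hmS) (not_lt.2 (hx.monotone (not_lt.1 hjm)))
      · by_contra hj
        have hmem : j ∈ Finset.univ.filter (fun j : Fin (t + 1) => ξ < x j) := Finset.mem_filter.2 ⟨Finset.mem_univ _, not_le.1 hj⟩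
        exact absurd (Finset.min'_le _ _ hmem) (not_le.2 h)
    obtain ⟨-, h2, h3⟩ := chebyshev_markov_stieltjes hx hν hmom m
    have hsub : ∑ l ∈ Finset.univ.filter (fun l => w l ≤ ξ), ν l ≤ ∑ l ∈ Finset.univ.filter (fun l => w l < x m), ν l :=
      Finset.sum_le_sum_of_subset_of_nonneg (fun l hl => Finset.mem_filter.2 ⟨Finset.mem_univ _, (Finset.mem_filter.1 hl).2.trans_lt hmS⟩) fun l _ _ => hν l
    rw [hstep, ← sub_le_iff_le_add]
    have h4 := sum_filter_le_eq_sum_filter_lt_add μ m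
    linarith [hM m]
  · -- no node above `ξ`: the step function is the total mass
    rw [Finset.not_nonempty_iff_eq_empty, Finset.filter_eq_empty_iff] at hS
    have hall : Finset.univ.filter (fun j => x j ≤ ξ) = Finset.univ := Finset.filter_true_of_mem fun j hj => not_lt.1 (hS hj)
    have htot : ∑ j, μ j = ∑ l, ν l := by simpa using hmom 0 (Nat.zero_le _)
    rw [hall, htot]
    have hsub : ∑ l ∈ Finset.univ.filter (fun l => w l ≤ ξ), ν l ≤ ∑ l, ν l :=
      Finset.sum_le_sum_of_subset_of_nonneg (Finset.filter_subset _ _) fun l _ _ => hν l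
    linarith

/-- **Lower bound between the nodes**: `Σ_{x_j ≤ ξ} λ_j − M ≤ ν{w ≤ ξ}` whenever `λ_j ≤ M` for all `j` and `0 ≤ M`. [Szegő Thm 3.41.1; this file, §1076] -/
theorem gaussStep_sub_le_mass_le {t N : ℕ} {μ x : Fin (t + 1) → ℝ} {ν w : Fin N → ℝ} (hx : StrictMono x) (hν : ∀ l, 0 ≤ ν l)
    (hmom : ∀ p, p ≤ 2 * t → ∑ j, μ j * x j ^ p = ∑ l, ν l * w l ^ p) {M : ℝ} (hM : ∀ j, μ j ≤ M) (hM0 : 0 ≤ M) (ξ : ℝ) :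
    ∑ j ∈ Finset.univ.filter (fun j => x j ≤ ξ), μ j - M ≤ ∑ l ∈ Finset.univ.filter (fun l => w l ≤ ξ), ν l := by
  by_cases hT : (Finset.univ.filter (fun j : Fin (t + 1) => x j ≤ ξ)).Nonempty
  · set k := (Finset.univ.filter (fun j : Fin (t + 1) => x j ≤ ξ)).max' hT with hk
    have hkT : x k ≤ ξ := (Finset.mem_filter.1 (Finset.max'_mem _ hT)).2
    have hstep : Finset.univ.filter (fun j => x j ≤ ξ) = Finset.univ.filter (fun j => j ≤ k) := by
      refine Finset.filter_congr fun j _ => ⟨fun h => ?_, fun h => (hx.monotone h).trans hkT⟩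
      rw [hk]
      exact Finset.le_max' (Finset.univ.filter (fun j : Fin (t + 1) => x j ≤ ξ)) j (Finset.mem_filter.2 ⟨Finset.mem_univ j, h⟩)
    obtain ⟨h1, h2, -⟩ := chebyshev_markov_stieltjes hx hν hmom k
    have hsub : ∑ l ∈ Finset.univ.filter (fun l => w l ≤ x k), ν l ≤ ∑ l ∈ Finset.univ.filter (fun l => w l ≤ ξ), ν l :=
      Finset.sum_le_sum_of_subset_of_nonneg (fun l hl => Finset.mem_filter.2 ⟨Finset.mem_univ _, (Finset.mem_filter.1 hl).2.trans hkT⟩) fun l _ _ => hν l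
    rw [hstep, sum_filter_le_eq_sum_filter_lt_add μ k]
    linarith [hM k]
  · rw [Finset.not_nonempty_iff_eq_empty] at hT
    rw [hT, Finset.sum_empty]
    have h0 : 0 ≤ ∑ l ∈ Finset.univ.filter (fun l => w l ≤ ξ), ν l := Finset.sum_nonneg fun l _ => hν l
    linarith

/-- **SZEGŐ 3.41.1 BETWEEN THE NODES: `|ν{w ≤ ξ} − Σ_{x_j ≤ ξ} λ_j| ≤ max_j λ_j`** (stated with any common bound `M ≥ λ_j`, `M ≥ 0`), for EVERY real `ξ`, whenever the rule `(λ, x)` with strictly increasing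
nodes is exact for `ν ≥ 0` in degree `≤ 2t`. [Szegő Thm 3.41.1; Freud Thm I.5.4; Akhiezer Thm 2.5.4; this file, §1076] -/
theorem abs_mass_le_sub_gaussStep_le {t N : ℕ} {μ x : Fin (t + 1) → ℝ} {ν w : Fin N → ℝ} (hx : StrictMono x) (hν : ∀ l, 0 ≤ ν l)
    (hmom : ∀ p, p ≤ 2 * t → ∑ j, μ j * x j ^ p = ∑ l, ν l * w l ^ p) {M : ℝ} (hM : ∀ j, μ j ≤ M) (hM0 : 0 ≤ M) (ξ : ℝ) :
    |∑ l ∈ Finset.univ.filter (fun l => w l ≤ ξ), ν l - ∑ j ∈ Finset.univ.filter (fun j => x j ≤ ξ), μ j| ≤ M := by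
  rw [abs_sub_le_iff]
  constructor
  · linarith [mass_le_le_gaussStep_add hx hν hmom hM hM0 ξ]
  · linarith [gaussStep_sub_le_mass_le hx hν hmom hM hM0 ξ]

/-- **A parameter-free form**: for non-negative weights, `|ν{w ≤ ξ} − Σ_{x_j ≤ ξ} λ_j| ≤ Σ_l ν_l` (take `M = Σ_j λ_j = Σ_l ν_l`). [mechanism; this file, §1076] -/
theorem abs_mass_le_sub_gaussStep_le_sum {t N : ℕ} {μ x : Fin (t + 1) → ℝ} {ν w : Fin N → ℝ} (hx : StrictMono x) (hν : ∀ l, 0 ≤ ν l) (hμ : ∀ j, 0 ≤ μ j)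
    (hmom : ∀ p, p ≤ 2 * t → ∑ j, μ j * x j ^ p = ∑ l, ν l * w l ^ p) (ξ : ℝ) :
    |∑ l ∈ Finset.univ.filter (fun l => w l ≤ ξ), ν l - ∑ j ∈ Finset.univ.filter (fun j => x j ≤ ξ), μ j| ≤ ∑ l, ν l := by
  have htot : ∑ j, μ j = ∑ l, ν l := by simpa using hmom 0 (Nat.zero_le _)
  rw [← htot]
  exact abs_mass_le_sub_gaussStep_le hx hν hmom (fun j => Finset.single_le_sum (fun i _ => hμ i) (Finset.mem_univ j)) (Finset.sum_nonneg fun j _ => hμ j) ξ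

end Summit.Ventures.HSemireg.Wedge.HankelOuter
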